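import Summits.ResolutionOfSingularities.ResolutionOfSingularities.Theorems.WeightedInvariantAQSBaseChangeFace
import Summits.ResolutionOfSingularities.ResolutionOfSingularities.Theorems.WeightedInvariantAQSBaseChangeBinomial
import Summits.ResolutionOfSingularities.ResolutionOfSingularities.Theorems.WeightedInvariantWeightedConstructionWeightedChartBasicOpen
import HarnessLib

/-!
# Descent of steepenings and of tangent `ν`-fold lines along an unramified extension of regular local rings

Route `ResolutionOfSingularities/WeightedInvariant`, door crux `HypersurfaceCentreConstruction`
(stmt-ResolutionOfSingularities-19897) — OURS, helper; e-ladder `e = 1`, piece **(o25-δ)** «separable base change of the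
Abramovich–Quek–Schober centre in the kernel» (res-D-pv-025 AS stub-10; CHAIN w43 v4.18 (3)), brick **(δ1b)**.

Setting: `φ : S → S′` a local homomorphism of two-dimensional regular local rings with `𝔪_S · S′ = 𝔪_{S′}` (so a regular
system of parameters `(x, y)` of `S` maps to one of `S′`), whose residue field extension `κ → κ′` is relatively
`p`-radically closed (`z ∈ κ′`, `z^p ∈ κ ⇒ z ∈ κ`; e.g. `κ′/κ` formally smooth, file `…AQSBaseChangeResidueField`).  No flatness
is used in this file.

* `exists_steepening_of_map` — **steepenings descend**: if over `S′` some `y ↦ y - λ′ x^b` (`λ′ ∈ S′`, `b ≥ 1`) prepares `f`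
  at level `b`, i.e. `φ f ≡ c′·(φ y - λ′ φ x^b)^ν` modulo `𝒥_{bν+1}((φx, φy); (1,b))` with `c′` a unit, then some `λ ∈ S` does:
  `f ≡ c·(y - λ x^b)^ν` modulo `𝒥_{bν+1}((x,y);(1,b))`, `c` a unit (face read over `κ′` by `residue_faceCoeff_sub_mem`, `λ̄′ ∈ κ`
  by `mem_range_of_forall_choose_mul_pow_mem`, lifted by `sub_sum_mem_of_faceCoeff_sub_mem`);
* `exists_tangent_line_of_map` — **tangent `ν`-fold lines descend**: if `φ f ≡ c′·y′^ν` modulo `𝔪′^{ν+1}` for a regular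
  parameter `y′` of `S′` and a unit `c′`, then `f ≡ c·y₀^ν` modulo `𝔪^{ν+1}` for a regular parameter `y₀` of `S` and a unit
  `c` (`exists_descent_of_forall_choose_mul_pow_mul_pow_mem`).

These are the two places where separability of the base change enters the stability of the lex-maximal centre
(Abramovich–Quek–Schober, Thm 3.5: «the characteristic polyhedron does not change under the base change `k′/k`»).
Def-free; no named facts; nothing here is a claim about Hironaka's problem.  AI-written; weaker than expert review.
-/

noncomputable section

set_option linter.dupNamespace false -- mandated namespace of this single-conjunct summit

namespace Summit.ResolutionOfSingularities.ResolutionOfSingularities.Theorems.AQSBaseChange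

open IsLocalRing Literature.AlgebraicGeometry.Resolution
open Summit.ResolutionOfSingularities.ResolutionOfSingularities.Theorems.LocalGameEFTNewton
  (span_range_vecCons_eq exists_unitExpansion)

universe u v

/-! ## Small tools -/

section Tools

variable {S : Type u} {S' : Type v} [CommRing S] [CommRing S']

/-- `φ ∘ (x, y) = (φ x, φ y)` as `Fin 2`-families. [folklore] -/
theorem comp_vecCons_two (φ : S →+* S') (x y : S) : (fun i => φ ((![x, y] : Fin 2 → S) i)) = ![φ x, φ y] := by
  funext i
  fin_cases i <;> rfl

/-- Weighted monomial ideals of `(x, y)` extend to those of `(φ x, φ y)`. [folklore] -/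
theorem map_weightedMonomialIdeal_two (φ : S →+* S') (x y : S) (w : Fin 2 → ℕ) (n : ℕ) :
    (weightedMonomialIdeal ![x, y] w n).map φ = weightedMonomialIdeal ![φ x, φ y] w n := by
  rw [weightedMonomialIdeal_map, comp_vecCons_two]

/-- A regular system of parameters maps to one when `𝔪_S · S′ = 𝔪_{S′}`. [folklore] -/
theorem span_pair_map_eq [IsLocalRing S] [IsLocalRing S'] (φ : S →+* S')
    (h𝔪 : (maximalIdeal S).map φ = maximalIdeal S') {x y : S} (hxy : Ideal.span {x, y} = maximalIdeal S) :
    Ideal.span {φ x, φ y} = maximalIdeal S' := by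
  rw [← h𝔪, ← hxy, Ideal.map_span, Set.image_pair]

/-- If `a x + u y` with `u` a unit: `(x, a x + u y) = (x, y)`. [folklore] -/
theorem span_pair_add_mul_eq (x y a : S) {u : S} (hu : IsUnit u) :
    Ideal.span {x, a * x + u * y} = Ideal.span {x, y} := by
  rw [Ideal.span_pair_mul_left_add, Ideal.span_insert, Ideal.span_singleton_mul_left_unit hu,
    ← Ideal.span_insert]

end Tools

/-! ## The descent setting -/

section Descent

variable {S : Type u} {S' : Type v} [CommRing S] [CommRing S'] [IsRegularLocalRing S] [IsRegularLocalRing S']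
  [Algebra S S'] [IsLocalHom (algebraMap S S')]
  (hdim : ringKrullDim S = (2 : ℕ)) (hdim' : ringKrullDim S' = (2 : ℕ))
  (h𝔪 : (maximalIdeal S).map (algebraMap S S') = maximalIdeal S')
  (p : ℕ) [ExpChar (ResidueField S') p]
  (hcl : ∀ z : ResidueField S', z ^ p ∈ (ResidueField.map (algebraMap S S')).range →
    z ∈ (ResidueField.map (algebraMap S S')).range)
  {x y : S} (hxy : Ideal.span {x, y} = maximalIdeal S)

/-- Residues along `(algebraMap S S')`: `ι (res a) = res ((algebraMap S S') a)` where `ι` is the residue field map. [folklore] -/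
theorem map_residue_algebraMap (a : S) :
    ResidueField.map (algebraMap S S') (residue S a) = residue S' (algebraMap S S' a) := rfl

/-- An element of `κ′` in the image of `κ` is the residue of an element coming from `S`. [folklore] -/
theorem exists_algebraMap_sub_mem_of_mem_range {z : ResidueField S'}
    (hz : z ∈ (ResidueField.map (algebraMap S S')).range) :
    ∃ a : S, residue S' (algebraMap S S' a) = z := by
  obtain ⟨w, hw⟩ := hz
  obtain ⟨a, rfl⟩ := residue_surjective w
  exact ⟨a, hw⟩

include hdim hdim' h𝔪 hcl hxy in
/-- **Steepenings descend.**  See the module docstring. [cite: AbramovichQuekSchober2025, Thm 3.5 proof (b), p. 8] -/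
theorem exists_steepening_of_map {f : S} {b : ℕ} (hb : 0 < b) {ν : ℕ} (hν : 1 ≤ ν)
    (hf : f ∈ weightedMonomialIdeal ![x, y] ![1, b] (b * ν)) {c' lam' : S'} (hc' : IsUnit c')
    (h : algebraMap S S' f - c' * (algebraMap S S' y - lam' * algebraMap S S' x ^ b) ^ ν ∈
      weightedMonomialIdeal ![algebraMap S S' x, algebraMap S S' y] ![1, b] (b * ν + 1)) :
    ∃ c lam : S, IsUnit c ∧ f - c * (y - lam * x ^ b) ^ ν ∈ weightedMonomialIdeal ![x, y] ![1, b] (b * ν + 1) := by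
  classical
  have hu := span_range_vecCons_eq hxy
  have hxy' : Ideal.span {(algebraMap S S') x, (algebraMap S S') y} = maximalIdeal S' := span_pair_map_eq (algebraMap S S') h𝔪 hxy
  -- a unit expansion of `f` in `S`, pushed to `S′`
  obtain ⟨Δ, a, hunit, -, hr⟩ := exists_unitExpansion ![x, y] hu f (b * ν + 2)
  have hr' : (algebraMap S S') f - ∑ α ∈ Δ, (algebraMap S S') (a α) * ∏ i, (![(algebraMap S S') x, (algebraMap S S') y] : Fin 2 → S') i ^ α i ∈
      maximalIdeal S' ^ (b * ν + 2) := by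
    have h1 : (algebraMap S S') (f - ∑ α ∈ Δ, a α * ∏ i, (![x, y] : Fin 2 → S) i ^ α i) ∈ maximalIdeal S' ^ (b * ν + 2) := by
      rw [← h𝔪, ← Ideal.map_pow]; exact Ideal.mem_map_of_mem _ hr
    have h2 : (algebraMap S S') (f - ∑ α ∈ Δ, a α * ∏ i, (![x, y] : Fin 2 → S) i ^ α i) =
        (algebraMap S S') f - ∑ α ∈ Δ, (algebraMap S S') (a α) * ∏ i, (![(algebraMap S S') x, (algebraMap S S') y] : Fin 2 → S') i ^ α i := by
      rw [map_sub, map_sum]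
      congr 1
      refine Finset.sum_congr rfl fun α _ => ?_
      rw [map_mul, map_prod]
      congr 1
      refine Finset.prod_congr rfl fun i _ => ?_
      rw [map_pow, ← comp_vecCons_two (algebraMap S S') x y]
    rw [h2] at h1; exact h1
  have hunit' : ∀ α ∈ Δ, IsUnit ((algebraMap S S') (a α)) := fun α hα => (hunit α hα).map (algebraMap S S')
  have hf' : (algebraMap S S') f ∈ weightedMonomialIdeal ![(algebraMap S S') x, (algebraMap S S') y] ![1, b] (b * ν) := by
    rw [← map_weightedMonomialIdeal_two]; exact Ideal.mem_map_of_mem _ hf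
  -- read the face over `κ′`
  have hq' : (algebraMap S S') f - ∑ k ∈ Finset.range (ν + 1), (c' * (ν.choose k : S') * (-lam') ^ k) *
      ((algebraMap S S') x ^ (b * k) * (algebraMap S S') y ^ (ν - k)) ∈ weightedMonomialIdeal ![(algebraMap S S') x, (algebraMap S S') y] ![1, b] (b * ν + 1) := by
    rw [← mul_sub_pow_eq_sum]; exact h
  have hface' := fun k (hk : k ≤ ν) =>
    residue_faceCoeff_sub_mem hdim' hxy' hunit' hr' hb (by omega) hf' _ hq' hk
  -- the face coefficients come from `S`: apply the binomial descent over the residue fields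
  letI : Algebra (ResidueField S) (ResidueField S') := (ResidueField.map (algebraMap S S')).toAlgebra
  have hιdef : algebraMap (ResidueField S) (ResidueField S') = ResidueField.map (algebraMap S S') := rfl
  have hc'0 : residue S' c' ≠ 0 := (residue_ne_zero_iff_isUnit c').mpr hc'
  have hcoef : ∀ k ≤ ν, residue S' c' * (ν.choose k : ResidueField S') * residue S' (-lam') ^ k ∈
      (algebraMap (ResidueField S) (ResidueField S')).range := by
    intro k hk
    refine ⟨residue S (if (![b * k, ν - k] : Fin 2 → ℕ) ∈ Δ then a ![b * k, ν - k] else 0), ?_⟩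
    rw [hιdef, map_residue_algebraMap]
    have e := (Ideal.Quotient.eq (I := maximalIdeal S')).mpr (hface' k hk)
    change residue S' _ = residue S' _ at e
    rw [apply_ite (algebraMap S S'), map_zero, e]
    simp only [map_mul, map_natCast, map_pow]
  obtain ⟨⟨m₀, hm₀⟩, ⟨γ₀, hγ₀⟩⟩ :=
    mem_range_of_forall_choose_mul_pow_mem p (by rw [hιdef]; exact hcl) hν hc'0 hcoef
  obtain ⟨m, hm⟩ := exists_algebraMap_sub_mem_of_mem_range (S := S) ⟨m₀, hm₀⟩
  obtain ⟨c, hc⟩ := exists_algebraMap_sub_mem_of_mem_range (S := S) ⟨γ₀, hγ₀⟩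
  -- `c` is a unit, `lam := -m`
  have hcunit : IsUnit c := by
    have : IsUnit ((algebraMap S S') c) := (residue_ne_zero_iff_isUnit ((algebraMap S S') c)).mp (by rw [hc]; exact hc'0)
    exact (isUnit_map_iff (algebraMap S S') c).mp this
  refine ⟨c, -m, hcunit, ?_⟩
  rw [mul_sub_pow_eq_sum]
  refine sub_sum_mem_of_faceCoeff_sub_mem hdim hxy hunit hr hb (by omega) hf _ fun k hk => ?_
  -- residues agree with those of the face coefficients, since they do after `ι` (injective)
  rw [← Ideal.Quotient.eq]
  change residue S _ = residue S _
  apply (ResidueField.map (algebraMap S S')).injective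
  rw [map_residue_algebraMap, map_residue_algebraMap]
  have e := (Ideal.Quotient.eq (I := maximalIdeal S')).mpr (hface' k hk)
  change residue S' _ = residue S' _ at e
  rw [apply_ite (algebraMap S S'), map_zero, e]
  simp only [map_mul, map_natCast, map_pow, map_neg, hc, hm, neg_neg]

include hdim hdim' h𝔪 hcl hxy in
/-- **Tangent `ν`-fold lines descend.**  See the module docstring. [cite: AbramovichQuekSchober2025, Thm 3.5 proof (a), p. 8] -/
theorem exists_tangent_line_of_map {f : S} {ν : ℕ} (hν : 1 ≤ ν) (hf : f ∈ maximalIdeal S ^ ν)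
    {x' y' c' : S'} (hxy'' : Ideal.span {x', y'} = maximalIdeal S') (hc' : IsUnit c')
    (h : algebraMap S S' f - c' * y' ^ ν ∈ maximalIdeal S' ^ (ν + 1)) :
    ∃ x₀ y₀ c : S, Ideal.span {x₀, y₀} = maximalIdeal S ∧ IsUnit c ∧ f - c * y₀ ^ ν ∈ maximalIdeal S ^ (ν + 1) := by
  classical
  have hu := span_range_vecCons_eq hxy
  have hxy' : Ideal.span {(algebraMap S S') x, (algebraMap S S') y} = maximalIdeal S' := span_pair_map_eq (algebraMap S S') h𝔪 hxy
  -- `y' = s φx + t φy`, not both coefficients in `𝔪′`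
  obtain ⟨s, t, hst⟩ : ∃ s t : S', s * (algebraMap S S') x + t * (algebraMap S S') y = y' :=
    Ideal.mem_span_pair.mp (by rw [hxy']; exact hxy'' ▸ Ideal.subset_span (by simp))
  have hst𝔪 : ¬ (s ∈ maximalIdeal S' ∧ t ∈ maximalIdeal S') := by
    rintro ⟨hs, ht⟩
    apply (LocalGameEFTSteepening.not_mem_sq_of_span_pair_eq hdim' hxy'').2
    rw [← hst, pow_two]
    exact Ideal.add_mem _ (Ideal.mul_mem_mul hs (hxy' ▸ Ideal.subset_span (by simp)))
      (Ideal.mul_mem_mul ht (hxy' ▸ Ideal.subset_span (by simp)))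
  -- unit expansion of `f` in `S`, pushed to `S′`; filtrations `(1,1)` are the `𝔪`-adic ones
  obtain ⟨Δ, a, hunit, -, hr⟩ := exists_unitExpansion ![x, y] hu f (1 * ν + 2)
  have hr' : (algebraMap S S') f - ∑ α ∈ Δ, (algebraMap S S') (a α) * ∏ i, (![(algebraMap S S') x, (algebraMap S S') y] : Fin 2 → S') i ^ α i ∈
      maximalIdeal S' ^ (1 * ν + 2) := by
    have h1 : (algebraMap S S') (f - ∑ α ∈ Δ, a α * ∏ i, (![x, y] : Fin 2 → S) i ^ α i) ∈ maximalIdeal S' ^ (1 * ν + 2) := by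
      rw [← h𝔪, ← Ideal.map_pow]; exact Ideal.mem_map_of_mem _ hr
    have h2 : (algebraMap S S') (f - ∑ α ∈ Δ, a α * ∏ i, (![x, y] : Fin 2 → S) i ^ α i) =
        (algebraMap S S') f - ∑ α ∈ Δ, (algebraMap S S') (a α) * ∏ i, (![(algebraMap S S') x, (algebraMap S S') y] : Fin 2 → S') i ^ α i := by
      rw [map_sub, map_sum]
      congr 1
      refine Finset.sum_congr rfl fun α _ => ?_
      rw [map_mul, map_prod]
      congr 1
      refine Finset.prod_congr rfl fun i _ => ?_
      rw [map_pow, ← comp_vecCons_two (algebraMap S S') x y]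
    rw [h2] at h1; exact h1
  have hunit' : ∀ α ∈ Δ, IsUnit ((algebraMap S S') (a α)) := fun α hα => (hunit α hα).map (algebraMap S S')
  have hJ : ∀ n, weightedMonomialIdeal ![x, y] ![1, 1] n = maximalIdeal S ^ n := fun n => by
    rw [LocalGameEFTSteepening.weightedMonomialIdeal_one_eq_pow, hxy]
  have hJ' : ∀ n, weightedMonomialIdeal ![(algebraMap S S') x, (algebraMap S S') y] ![1, 1] n = maximalIdeal S' ^ n := fun n => by
    rw [LocalGameEFTSteepening.weightedMonomialIdeal_one_eq_pow, hxy']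
  have hfJ : f ∈ weightedMonomialIdeal ![x, y] ![1, 1] (1 * ν) := by rw [hJ, one_mul]; exact hf
  have hf' : (algebraMap S S') f ∈ weightedMonomialIdeal ![(algebraMap S S') x, (algebraMap S S') y] ![1, 1] (1 * ν) := by
    rw [← map_weightedMonomialIdeal_two]; exact Ideal.mem_map_of_mem _ hfJ
  have hq' : (algebraMap S S') f - ∑ k ∈ Finset.range (ν + 1), (c' * (ν.choose k : S') * s ^ k * t ^ (ν - k)) *
      ((algebraMap S S') x ^ (1 * k) * (algebraMap S S') y ^ (ν - k)) ∈ weightedMonomialIdeal ![(algebraMap S S') x, (algebraMap S S') y] ![1, 1] (1 * ν + 1) := by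
    rw [← mul_linear_pow_eq_sum, hst, hJ', one_mul]; exact h
  have hface' := fun k (hk : k ≤ ν) =>
    residue_faceCoeff_sub_mem hdim' hxy' hunit' hr' Nat.one_pos (by omega) hf' _ hq' hk
  -- binomial descent over the residue fields
  letI : Algebra (ResidueField S) (ResidueField S') := (ResidueField.map (algebraMap S S')).toAlgebra
  have hιdef : algebraMap (ResidueField S) (ResidueField S') = ResidueField.map (algebraMap S S') := rfl
  have hc'0 : residue S' c' ≠ 0 := (residue_ne_zero_iff_isUnit c').mpr hc'
  have hst0 : residue S' s ≠ 0 ∨ residue S' t ≠ 0 := by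
    by_contra hcon
    push Not at hcon
    exact hst𝔪 ⟨(residue_eq_zero_iff s).mp hcon.1, (residue_eq_zero_iff t).mp hcon.2⟩
  have hcoef : ∀ k ≤ ν, residue S' c' * (ν.choose k : ResidueField S') * residue S' s ^ k * residue S' t ^ (ν - k) ∈
      (algebraMap (ResidueField S) (ResidueField S')).range := by
    intro k hk
    refine ⟨residue S (if (![1 * k, ν - k] : Fin 2 → ℕ) ∈ Δ then a ![1 * k, ν - k] else 0), ?_⟩
    rw [hιdef, map_residue_algebraMap]
    have e := (Ideal.Quotient.eq (I := maximalIdeal S')).mpr (hface' k hk)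
    change residue S' _ = residue S' _ at e
    rw [apply_ite (algebraMap S S'), map_zero, e]
    simp only [map_mul, map_natCast, map_pow]
  obtain ⟨c₀, α₀, β₀, hc₀, hcoef₀⟩ :=
    exists_descent_of_forall_choose_mul_pow_mul_pow_mem p (by rw [hιdef]; exact hcl) hν hc'0 hst0 hcoef
  obtain ⟨a₀, rfl⟩ := residue_surjective α₀
  obtain ⟨b₀, rfl⟩ := residue_surjective β₀
  obtain ⟨c, rfl⟩ := residue_surjective c₀
  have hcunit : IsUnit c := (residue_ne_zero_iff_isUnit c).mp hc₀
  -- lift: `f ≡ c (a₀ x + b₀ y)^ν` modulo `𝔪^{ν+1}`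
  have hlift : f - c * (a₀ * x + b₀ * y) ^ ν ∈ maximalIdeal S ^ (ν + 1) := by
    rw [mul_linear_pow_eq_sum, ← hJ]
    have H := sub_sum_mem_of_faceCoeff_sub_mem hdim hxy hunit hr Nat.one_pos (by omega) hfJ
      (fun k => c * (ν.choose k : S) * a₀ ^ k * b₀ ^ (ν - k)) fun k hk => ?_
    · simp only [one_mul] at H ⊢
      exact H
    rw [← Ideal.Quotient.eq]
    change residue S _ = residue S _
    apply (ResidueField.map (algebraMap S S')).injective
    rw [map_residue_algebraMap]
    have e := (Ideal.Quotient.eq (I := maximalIdeal S')).mpr (hface' k hk)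
    change residue S' _ = residue S' _ at e
    rw [apply_ite (algebraMap S S'), map_zero, e]
    have H' := hcoef₀ k hk
    rw [hιdef] at H'
    simp only [map_mul, map_natCast, map_pow] at H' ⊢
    exact H'.symm
  -- a regular system of parameters through `a₀ x + b₀ y`
  by_cases hb₀ : IsUnit b₀
  · exact ⟨x, a₀ * x + b₀ * y, c, by rw [span_pair_add_mul_eq x y a₀ hb₀, hxy], hcunit, hlift⟩
  · have ha₀ : IsUnit a₀ := by
      by_contra ha₀
      have hα : residue S a₀ = 0 := (residue_eq_zero_iff a₀).mpr ((mem_maximalIdeal _).mpr (mem_nonunits_iff.mpr ha₀))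
      have hβ : residue S b₀ = 0 := (residue_eq_zero_iff b₀).mpr ((mem_maximalIdeal _).mpr (mem_nonunits_iff.mpr hb₀))
      have hν0 : ν ≠ 0 := by omega
      have eν := hcoef₀ ν le_rfl
      have e0 := hcoef₀ 0 (Nat.zero_le ν)
      simp only [hα, hβ, zero_pow hν0, mul_zero, map_zero, Nat.sub_self, Nat.sub_zero, pow_zero, mul_one,
        Nat.choose_self, Nat.choose_zero_right, Nat.cast_one] at eν e0
      rcases hst0 with h0 | h0
      · exact h0 ((pow_eq_zero_iff hν0).mp ((mul_eq_zero.mp eν.symm).resolve_left hc'0))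
      · exact h0 ((pow_eq_zero_iff hν0).mp ((mul_eq_zero.mp e0.symm).resolve_left hc'0))
    refine ⟨y, a₀ * x + b₀ * y, c, ?_, hcunit, hlift⟩
    rw [show a₀ * x + b₀ * y = b₀ * y + a₀ * x by ring, span_pair_add_mul_eq y x b₀ ha₀, Ideal.span_pair_comm, hxy]

end Descent

end Summit.ResolutionOfSingularities.ResolutionOfSingularities.Theorems.AQSBaseChange

end
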